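import Summits.BirchSwinnertonDyer.BirchSwinnertonDyer.Theorems.Rank2Observatory2DescVCover
import Summits.BirchSwinnertonDyer.BirchSwinnertonDyer.Theorems.Rank2Observatory2DescUnitsModSq
import Summits.BirchSwinnertonDyer.BirchSwinnertonDyer.Theorems.Rank2Observatory2DescSignature
import Summits.BirchSwinnertonDyer.BirchSwinnertonDyer.Theorems.Rank2Observatory2DescCertificates
import Summits.BirchSwinnertonDyer.BirchSwinnertonDyer.Theorems.Rank2Observatory2DescLinGens
import Summits.BirchSwinnertonDyer.BirchSwinnertonDyer.Theorems.Rank2Observatory2DescIrredModP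
import Summits.BirchSwinnertonDyer.BirchSwinnertonDyer.Theorems.Rank2Observatory2DescPIDCertB
import Literature.NumberTheory.NumberFields.CubicFieldConductor
import Literature.NumberTheory.IwasawaTheory.ClassNumberPExpLayerOneEqOneOfGenusCertificate
import Mathlib.Tactic.NormNum.Prime
import HarnessLib

/-!
# Route `AlignedTransportAtTwo`, crux C2 `MainConjectureOfRankZeroBSDAtTwo` (stmt-BirchSwinnertonDyer-22298):
# THE FIRST KERNEL `e₁` ON THE OFF-STRATUM SUB-CELL — for the cubic field `K` of `X³ − 5X² − X − 2` (`d_K = −1259`, the `2`-torsion field of the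
# rank-`0` odd-branch seed `[1,−1,1,−3,−2]`, `Δ_min = −1259 ≡ 5 (mod 8)`, `σ₁(ε) ≡ 7 (mod 8)`): **`ord₂ h(K_1) = 1` for EVERY cyclotomic `ℤ₂`-extension of `K`**,
# by the ODD genus-character certificate `x² − 2y² = uα²` with `N(α) = 7`, `α ≡ −3 (mod 𝔭₁³)`

HONEST FRAMING (cell `bsd-f1-sign2`, WIDTH-5 attached prover seat `bsd-line-att-p3` gen 43 on line `birth` of the lead `bsd-line-att-p2`; `--supports`
stmt-BirchSwinnertonDyer-22298, closes nothing; BSD is NOT proved by any of this; the crux C2, its verdict «blocked-on `Rank1Residual.GreenbergMuConjectureIrreducible`»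
and every registered stub are untouched).  THEOREMS + two `Fact`/PID instances on the concrete field type `CubicField (-5) (-1) (-2)` exactly as in the
`Rank2ObservatoryCubicField…` template (b2b KERNEL-2DESC instrument), whose toolkit (`lin`, `cert_of_cases`, `isPrincipalIdealRing_of_cert_lt`, parity certificates)
is reused verbatim.  W-free: the identification `ℚ(β) ≃ K` for the seed is NOT made here (successor).

WHAT.  `K = CubicField (-5) (-1) (-2)` (`α³ = 5α² + α + 2`): §1 `𝓞_K` is a PID (`64·1259 < 799·11²`; degree-one certificates at `2` (`α`, norm `2`) and `7`
(`α−1, α−5, α+1`, norm `7`); no roots mod `3, 5`), unit rank `1`, `d_K = −1259`; §2 the units `−1`, `fu = 3 + 2α + 8α²` (inverse `−5 + 22α − 4α²`) are independent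
modulo squares (real sign at `ρ(α) ∈ (5,6)`; Legendre at `ψ₇ : α ↦ 5`, `fu ↦ 3`), so `fu`, `−fu` are non-squares; §3 the dyadic primes `𝔭₁ = (α)` (norm `2`),
`𝔭₂ = (α² − 5α − 1)` (norm `4`), `𝔭₁𝔭₂ = (2)`, hence at most two primes above `2`; §4 THE CERTIFICATE: `fu + 1 = (3 + 5α − α²)·α³ ∈ 𝔭₁³`;
`x = −1 − α`, `y = −α`, `α' = α − 5` (norm `7`), `u = −fu`: `x² − 2y² = u·α'²`; Bézout `α²·α' + 1·x = 1`, `(11 + 7α + 24α²)·α'² − 24·2 = 1`;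
`α' + 3 = α − 2 = (−8 − 9α + 2α²)·α³ ∈ 𝔭₁³`; ★★ **`classNumberPExp_one_eq_one` — `classNumberPExp κ 1 = 1` for every cyclotomic `ℤ₂`-extension `κ` of `K`**
(this seat's Literature `classNumberPExp_one_eq_one_of_genusCert_odd_of_rank_eq_one`).  CELL READING: census memo `GENUS-CERT-att-p3-g43.md` §2B predicted
`e₁ = 1` at `N = 1259` (genus regime (β): `𝔓₂` principal, the `𝔭₂`-bit is `+1` and does NOT decide — g41's «`e₁ ≥ 2` at −1259» is hereby corrected); this file
is the kernel proof.  The seed is in the layer-one-unit-door class (`σ₁(ε) ≡ ±7 (mod 16)`), so this `e₁` is a datum, not a depth-door customer.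

References: [Gras2003] IV.4; [Serre1973CourseArithmetic] Ch. III §1.2 Thm. 1; [Marcus2018] Ch. 2 Thm. 9 / Ex. 27, Ch. 3 Thm. 27, Ch. 5 Thm. 37 Cor. 2;
[NeukirchANT1999] Ch. I §3, §7, Ch. III §1 (1.6); [Washington1997] §13.1; [LMFDB] number field 3.1.1259.1; tree: `Rank2ObservatoryCubicFieldM4039` (template),
this seat's `ClassNumberPExpLayerOneEqOneOfGenusCertificate` §4.
-/

set_option linter.dupNamespace false
set_option autoImplicit false

noncomputable section

open scoped Classical NumberField

open Literature.NumberTheory.NumberFields Polynomial Module NumberField IsDedekindDomain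
  Literature.NumberTheory.IwasawaTheory Literature.NumberTheory.EllipticCurves
  Summit.BirchSwinnertonDyer.BirchSwinnertonDyer.Rank2Observatory.TwoDescCubic

namespace Summit.BirchSwinnertonDyer.BirchSwinnertonDyer.Theorems.AlignedTransportAtTwoCubicFieldM1259LayerOne

/-! ## §1 The field `K = ℚ(α)`, `α³ − 5α² − α − 2 = 0`: PID, unit rank `1`, `d_K = −1259` -/

/-- `X³ − 5X² − X − 2` is irreducible over `ℚ` (no root modulo `3`). [cite: LMFDB, number field 3.1.1259.1] -/
theorem irreducible : Irreducible (MonicCubic.polyQ (-5) (-1) (-2)) :=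
  irreducible_polyQ_of_no_root_mod 3 (by decide)

/-- Irreducibility as an instance, so that `CubicField (-5) (-1) (-2)` is a field (template convention). [folklore] -/
instance : Fact (Irreducible (MonicCubic.polyQ (-5) (-1) (-2))) := ⟨irreducible⟩

/-- `g(α) = 0`. [folklore] -/
theorem aeval_α : aeval (CubicField.root (-5) (-1) (-2)) (MonicCubic.poly (-5) (-1) (-2)) = 0 :=
  CubicField.aeval_root (-5) (-1) (-2)

/-- `[K : ℚ] = 3`. [folklore] -/
theorem finrank_eq : finrank ℚ (CubicField (-5) (-1) (-2)) = 3 := CubicField.finrank_eq (-5) (-1) (-2)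

/-- `Δ(g) = −1259`. [cite: LMFDB, number field 3.1.1259.1] -/
theorem disc_eq : MonicCubic.disc (-5) (-1) (-2) = -1259 := by norm_num [MonicCubic.disc]

/-- `−1259 = r²e` with `|e| > 2` forces `r = ±1` (`1259` is prime). [cite: Marcus2018, Ch. 2, Exercise 27] -/
theorem isUnit_of_disc_eq_sq_mul : ∀ r e : ℤ, MonicCubic.disc (-5) (-1) (-2) = r ^ 2 * e → 2 < |e| → IsUnit r := by
  intro r e h _
  rw [disc_eq] at h
  have hdvd : r.natAbs ^ 2 ∣ 1259 := by
    have h1 : r ^ 2 ∣ (1259 : ℤ) := ⟨-e, by linear_combination -h⟩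
    have h2 : ((r.natAbs ^ 2 : ℕ) : ℤ) ∣ (1259 : ℕ) := by
      rw [Nat.cast_pow, Int.natCast_natAbs, sq_abs]; exact_mod_cast h1
    exact Int.natCast_dvd_natCast.mp h2
  have hle : r.natAbs ≤ 36 := by
    have := Nat.le_of_dvd (by norm_num) hdvd
    nlinarith
  rw [Int.isUnit_iff_natAbs_eq]
  interval_cases hr : r.natAbs <;> omega

/-- **`d_K = −1259`** (squarefree discriminant: `𝓞_K = ℤ[α]`). [cite: LMFDB, number field 3.1.1259.1] [cite: Marcus2018, Ch. 2, Exercise 27] -/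
theorem discr_eq : NumberField.discr (CubicField (-5) (-1) (-2)) = -1259 := by
  rw [MonicCubic.discr_eq_disc irreducible aeval_α finrank_eq isUnit_of_disc_eq_sq_mul, disc_eq]

/-- Certificate at `2`: the only root of `g` mod `2` is `0`, and `α` (norm `2`) is a prime element killed by `α ↦ 0`. [cite: Marcus2018, Ch. 3, Thm. 27] -/
theorem cert2 (ψ : 𝓞 (CubicField (-5) (-1) (-2)) →+* ZMod 2) : ∃ e : 𝓞 (CubicField (-5) (-1) (-2)), ψ e = 0 ∧ Prime e := by
  refine cert_of_cases aeval_α ψ (fun t ht hF => ?_)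
  have hroots : ∀ t : ZMod 2,
      t ^ 3 + (((-5) : ℤ) : ZMod 2) * t ^ 2 + (((-1) : ℤ) : ZMod 2) * t + (((-2) : ℤ) : ZMod 2) = 0 → t = 0 := by
    decide
  obtain rfl := hroots t hF
  exact ⟨lin aeval_α 0 1 0, by simp only [lin, map_add, map_mul, map_pow, map_intCast, ht]; decide,
      lin_prime_of_prime irreducible aeval_α finrank_eq 0 1 0 (n := 2)
        (by norm_num [MonicCubic.normForm]) (by norm_num)⟩

/-- Certificate at `3`: `g` has no root mod `3`. [folklore] -/
theorem cert3 (ψ : 𝓞 (CubicField (-5) (-1) (-2)) →+* ZMod 3) : ∃ e : 𝓞 (CubicField (-5) (-1) (-2)), ψ e = 0 ∧ Prime e :=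
  cert_of_no_root aeval_α ψ (by decide)

/-- Certificate at `5`: `g` has no root mod `5`. [folklore] -/
theorem cert5 (ψ : 𝓞 (CubicField (-5) (-1) (-2)) →+* ZMod 5) : ∃ e : 𝓞 (CubicField (-5) (-1) (-2)), ψ e = 0 ∧ Prime e :=
  cert_of_no_root aeval_α ψ (by decide)

/-- Certificate at `7`: the roots of `g` mod `7` are `1, 5, 6`; `α − 1`, `α − 5`, `α + 1` have norm `7`. [cite: Marcus2018, Ch. 3, Thm. 27] -/
theorem cert7 (ψ : 𝓞 (CubicField (-5) (-1) (-2)) →+* ZMod 7) : ∃ e : 𝓞 (CubicField (-5) (-1) (-2)), ψ e = 0 ∧ Prime e := by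
  refine cert_of_cases aeval_α ψ (fun t ht hF => ?_)
  have hroots : ∀ t : ZMod 7,
      t ^ 3 + (((-5) : ℤ) : ZMod 7) * t ^ 2 + (((-1) : ℤ) : ZMod 7) * t + (((-2) : ℤ) : ZMod 7) = 0 → t = 1 ∨ t = 5 ∨ t = 6 := by
    decide
  rcases hroots t hF with rfl | rfl | rfl
  · exact ⟨lin aeval_α (-1) 1 0, by simp only [lin, map_add, map_mul, map_pow, map_intCast, ht]; decide,
      lin_prime_of_prime irreducible aeval_α finrank_eq (-1) 1 0 (n := 7)
        (by norm_num [MonicCubic.normForm]) (by norm_num)⟩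
  · exact ⟨lin aeval_α (-5) 1 0, by simp only [lin, map_add, map_mul, map_pow, map_intCast, ht]; decide,
      lin_prime_of_prime irreducible aeval_α finrank_eq (-5) 1 0 (n := 7)
        (by norm_num [MonicCubic.normForm]) (by norm_num)⟩
  · exact ⟨lin aeval_α 1 1 0, by simp only [lin, map_add, map_mul, map_pow, map_intCast, ht]; decide,
      lin_prime_of_prime irreducible aeval_α finrank_eq 1 1 0 (n := 7)
        (by norm_num [MonicCubic.normForm]) (by norm_num)⟩

/-- The degree-one certificates at all primes below the Minkowski certificate bound `b = 11` (`64·1259 < 799·11²`). [cite: Marcus2018, Ch. 5, Cor. 2 of Thm 37] -/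
theorem cert (p : ℕ) (hpb : p < 11) (hp : p.Prime) (ψ : 𝓞 (CubicField (-5) (-1) (-2)) →+* ZMod p) :
    ∃ e : 𝓞 (CubicField (-5) (-1) (-2)), ψ e = 0 ∧ Prime e := by
  interval_cases p
  · exact absurd hp (by norm_num)
  · exact absurd hp (by norm_num)
  · exact cert2 ψ
  · exact cert3 ψ
  · exact absurd hp (by norm_num)
  · exact cert5 ψ
  · exact absurd hp (by norm_num)
  · exact cert7 ψ
  · exact absurd hp (by norm_num)
  · exact absurd hp (by norm_num)
  · exact absurd hp (by norm_num)

/-- `𝓞 K` is a PID (`64·|Δ| < 799·11²`, every degree-one prime below `11` principal). [cite: Marcus2018, Ch. 5, Cor. 2 of Thm 37] [cite: LMFDB, number field 3.1.1259.1 (class number 1)] -/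
instance : IsPrincipalIdealRing (𝓞 (CubicField (-5) (-1) (-2))) :=
  isPrincipalIdealRing_of_cert_lt irreducible aeval_α finrank_eq (b := 11) (by rw [disc_eq]; norm_num) cert

/-- `h_K = 1`, hence odd. [cite: LMFDB, number field 3.1.1259.1] -/
theorem odd_classNumber : Odd (classNumber (CubicField (-5) (-1) (-2))) := by
  rw [(classNumber_eq_one_iff).mpr inferInstance]; exact odd_one

/-- Unit rank `1` (`Δ < 0`). [cite: Marcus2018, Ch. 5] -/
theorem rank_eq : NumberField.Units.rank (CubicField (-5) (-1) (-2)) = 1 :=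
  units_rank_eq_one_of_disc_neg irreducible aeval_α finrank_eq (by rw [disc_eq]; norm_num)

/-- The relation `α³ = 2 + α + 5α²` in `𝓞 K`. [folklore] -/
theorem αi_rel : (MonicCubic.thetaInt aeval_α) ^ 3 = 2 + (MonicCubic.thetaInt aeval_α) + 5 * (MonicCubic.thetaInt aeval_α) ^ 2 := by
  have h := MonicCubic.thetaInt_rel aeval_α
  push_cast at h
  linear_combination h

/-- A real place `ρ` with `5 < ρ(α) < 6` (`g(5) = −7 < 0 < 28 = g(6)`). [folklore] -/
theorem exists_rho : ∃ ρ : (CubicField (-5) (-1) (-2)) →+* ℝ,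
    ((5 : ℚ) : ℝ) < ρ (CubicField.root (-5) (-1) (-2)) ∧ ρ (CubicField.root (-5) (-1) (-2)) < ((6 : ℚ) : ℝ) :=
  exists_real_embedding_of_sign_change irreducible aeval_α finrank_eq (by norm_num) (by norm_num) (by norm_num)

/-- `|Δ(g)| · x ∈ ℤ[α]` for every algebraic integer `x`. [cite: Marcus2018, Ch. 2, Thm. 9] -/
theorem absDisc_mul_mem (x : 𝓞 (CubicField (-5) (-1) (-2))) :
    ((1259 : ℕ) : (CubicField (-5) (-1) (-2))) * x ∈ Algebra.adjoin ℤ ({(CubicField.root (-5) (-1) (-2))} : Set (CubicField (-5) (-1) (-2))) := by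
  have h := neg_mem (MonicCubic.disc_mul_mem_adjoin irreducible aeval_α finrank_eq x)
  rw [disc_eq] at h
  have e : ((1259 : ℕ) : (CubicField (-5) (-1) (-2))) * x = -(((-1259 : ℤ) : (CubicField (-5) (-1) (-2))) * x) := by
    push_cast; ring
  rw [e]; exact h

/-- The residue map `ψ₇ : 𝓞 K → ℤ/7`, `α ↦ 5` (`g(5) ≡ 0`, `1259 ≡ 6`, `6·6 ≡ 1 (mod 7)`). [cite: Marcus2018, Ch. 3, Thm. 27] -/
theorem exists_psi7 : ∃ ψ : 𝓞 (CubicField (-5) (-1) (-2)) →+* ZMod 7, ψ (MonicCubic.thetaInt aeval_α) = 5 :=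
  MonicCubic.exists_ringHom_of_root_of_mul_mem irreducible aeval_α finrank_eq absDisc_mul_mem
    (5 : ZMod 7) (by decide) (6 : ZMod 7) (by decide)

/-- `7` is prime (instance for `legendreSym 7`). [folklore] -/
instance fact_prime_7 : Fact (Nat.Prime 7) := ⟨by norm_num⟩

/-! ## §2 The units `−1`, `fu = 3 + 2α + 8α²`: independent modulo squares -/

/-- The unit `−1` in `lin` form. [folklore] -/
def negOne : (𝓞 (CubicField (-5) (-1) (-2)))ˣ :=
  ⟨lin aeval_α (-1) 0 0, lin aeval_α (-1) 0 0, by simp [lin], by simp [lin]⟩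

/-- The unit `fu = 3 + 2α + 8α²` (inverse `−5 + 22α − 4α²`, the census unit `η` of the seed; `σ₁(fu) ≡ −1 (mod 8)`). [folklore] -/
def fu : (𝓞 (CubicField (-5) (-1) (-2)))ˣ :=
  ⟨lin aeval_α 3 2 8, lin aeval_α (-5) 22 (-4),
    by simp only [lin]; push_cast; linear_combination (8 - 32 * (MonicCubic.thetaInt aeval_α)) * αi_rel,
    by simp only [lin]; push_cast; linear_combination (8 - 32 * (MonicCubic.thetaInt aeval_α)) * αi_rel⟩

/-- The unit family `(−1, fu)`. [folklore] -/
def units : Fin 2 → (𝓞 (CubicField (-5) (-1) (-2)))ˣ := ![negOne, fu]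

/-- The unit family as elements of `𝓞 K`. [folklore] -/
theorem units_val (i : Fin 2) :
    ((units i : (𝓞 (CubicField (-5) (-1) (-2)))ˣ) : 𝓞 (CubicField (-5) (-1) (-2))) =
      (![lin aeval_α (-1) 0 0, lin aeval_α 3 2 8] : Fin 2 → 𝓞 (CubicField (-5) (-1) (-2))) i := by
  fin_cases i <;> rfl

/-- Signs at the real place: `−1 < 0`, `fu > 0` (all coefficients positive, `ρ(α) > 5 ≥ 0`). [folklore] -/
theorem units_sign (ρ : (CubicField (-5) (-1) (-2)) →+* ℝ) (hlo : ((5 : ℚ) : ℝ) < ρ (CubicField.root (-5) (-1) (-2)))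
    (hhi : ρ (CubicField.root (-5) (-1) (-2)) < ((6 : ℚ) : ℝ)) (i : Fin 2) :
    (![true, false] : Fin 2 → Bool) i = true ↔ ρ (((units i : (𝓞 (CubicField (-5) (-1) (-2)))ˣ) : 𝓞 (CubicField (-5) (-1) (-2))) :
      (CubicField (-5) (-1) (-2))) < 0 := by
  rw [units_val]
  fin_cases i
  · exact sg_true_iff_of_neg (lin_neg aeval_α ρ (by norm_num) hlo hhi (-1) 0 0 (by norm_num))
  · exact sg_false_iff_of_pos (lin_pos aeval_α ρ (by norm_num) hlo hhi 3 2 8 (by norm_num))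

/-- The units are non-zero at the real place. [folklore] -/
theorem units_real_ne_zero (ρ : (CubicField (-5) (-1) (-2)) →+* ℝ) (hlo : ((5 : ℚ) : ℝ) < ρ (CubicField.root (-5) (-1) (-2)))
    (hhi : ρ (CubicField.root (-5) (-1) (-2)) < ((6 : ℚ) : ℝ)) (i : Fin 2) :
    ρ (((units i : (𝓞 (CubicField (-5) (-1) (-2)))ˣ) : 𝓞 (CubicField (-5) (-1) (-2))) : (CubicField (-5) (-1) (-2))) ≠ 0 := by
  rw [units_val]
  fin_cases i
  · exact (lin_neg aeval_α ρ (by norm_num) hlo hhi (-1) 0 0 (by norm_num)).ne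
  · exact (lin_pos aeval_α ρ (by norm_num) hlo hhi 3 2 8 (by norm_num)).ne'

/-- Images under `ψ₇` (`α ↦ 5`): `−1 ↦ 6`, `fu ↦ 3`. [folklore] -/
theorem units_psi7 (ψ : 𝓞 (CubicField (-5) (-1) (-2)) →+* ZMod 7) (hψ : ψ (MonicCubic.thetaInt aeval_α) = 5) (i : Fin 2) :
    ψ ((units i : (𝓞 (CubicField (-5) (-1) (-2)))ˣ) : 𝓞 (CubicField (-5) (-1) (-2))) = ((![6, 3] : Fin 2 → ℤ) i : ZMod 7) := by
  fin_cases i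
  · show ψ (lin aeval_α (-1) 0 0) = ((6 : ℤ) : ZMod 7)
    simp only [lin, map_add, map_mul, map_pow, map_intCast, hψ]
    decide
  · show ψ (lin aeval_α 3 2 8) = ((3 : ℤ) : ZMod 7)
    simp only [lin, map_add, map_mul, map_pow, map_intCast, hψ]
    decide

/-- **The unit family is independent modulo squares** (parity certificate: real sign; Legendre character at `ψ₇`, `(6/7) = (3/7) = −1`). [folklore] -/
theorem units_indep (T : Finset (Fin 2)) (hT : IsSquare (∏ i ∈ T, units i)) : T = ∅ := by
  obtain ⟨ρ, hlo, hhi⟩ := exists_rho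
  obtain ⟨ψ7, hψ7⟩ := exists_psi7
  refine indep_units_of_indep_coe units ?_ T hT
  intro S hS
  refine indep_of_parity_certificate (fun i => (((units i : (𝓞 (CubicField (-5) (-1) (-2)))ˣ) : 𝓞 (CubicField (-5) (-1) (-2))) :
      (CubicField (-5) (-1) (-2))))
    (![![true, false], ![true, true]] : Fin 2 → Fin 2 → Bool) ?_ (by decide) S hS
  intro k S' hS'
  fin_cases k
  · have h := even_card_of_isSquare_real ρ (fun i => (((units i : (𝓞 (CubicField (-5) (-1) (-2)))ˣ) : 𝓞 (CubicField (-5) (-1) (-2))) :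
        (CubicField (-5) (-1) (-2)))) (units_real_ne_zero ρ hlo hhi) hS'
    convert h using 2
    refine Finset.filter_congr (fun i _ => ?_)
    have hs := units_sign ρ hlo hhi i
    fin_cases i <;> simpa using hs
  · have hS'' : IsSquare (∏ i ∈ S', ((units i : (𝓞 (CubicField (-5) (-1) (-2)))ˣ) : 𝓞 (CubicField (-5) (-1) (-2)))) :=
      isSquare_prod_of_isSquare_prod_coe _ hS'
    have h := even_card_of_isSquare_legendre (p := 7) ψ7 (fun i => ((units i : (𝓞 (CubicField (-5) (-1) (-2)))ˣ) : 𝓞 (CubicField (-5) (-1) (-2))))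
      (![6, 3] : Fin 2 → ℤ) (units_psi7 ψ7 hψ7) (by decide) hS''
    have h1 : legendreSym 7 6 = -1 :=
      (legendreSym.eq_neg_one_iff 7).mpr (by unfold IsSquare; decide)
    have h2 : legendreSym 7 3 = -1 :=
      (legendreSym.eq_neg_one_iff 7).mpr (by unfold IsSquare; decide)
    convert h using 2
    refine Finset.filter_congr (fun i _ => ?_)
    fin_cases i
    · simp [h1]
    · simp [h2]

/-- `fu` and `−fu` are not squares of units. [folklore] -/
theorem fu_ne_sq (z : (𝓞 (CubicField (-5) (-1) (-2)))ˣ) : fu ≠ z ^ 2 ∧ fu ≠ -z ^ 2 := by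
  constructor
  · intro h
    have hsq : IsSquare (∏ i ∈ ({1} : Finset (Fin 2)), units i) := by
      rw [Finset.prod_singleton]
      exact ⟨z, by rw [← sq]; exact h⟩
    exact absurd (units_indep {1} hsq) (by decide)
  · intro h
    have hsq : IsSquare (∏ i ∈ ({0, 1} : Finset (Fin 2)), units i) := by
      rw [Finset.prod_pair (by decide)]
      refine ⟨z, ?_⟩
      show negOne * fu = z * z
      rw [h, ← sq]
      ext
      simp [negOne, lin]
    exact absurd (units_indep {0, 1} hsq) (by decide)

/-! ## §3 The dyadic primes: `𝔭₁ = (α)` of norm `2`, `𝔭₂ = (α² − 5α − 1)` of norm `4`, `𝔭₁𝔭₂ = (2)`; at most two primes above `2` -/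

/-- `N(𝔭₁) = 2` for `𝔭₁ = (α)`. [cite: Marcus2018, Ch. 3, Thm. 22] -/
theorem absNorm_p1 : Ideal.absNorm (Ideal.span {lin aeval_α 0 1 0} : Ideal (𝓞 (CubicField (-5) (-1) (-2)))) = 2 := by
  rw [Ideal.absNorm_span_singleton, natAbs_norm_lin irreducible aeval_α finrank_eq 0 1 0 (n := 2) (by norm_num [MonicCubic.normForm])]
  rfl

/-- `α` is a prime element (norm `2`). [cite: Marcus2018, Ch. 3, Thm. 22] -/
theorem prime_p1 : Prime (lin aeval_α 0 1 0 : 𝓞 (CubicField (-5) (-1) (-2))) :=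
  lin_prime_of_prime irreducible aeval_α finrank_eq 0 1 0 (n := 2) (by norm_num [MonicCubic.normForm]) (by norm_num)

/-- `α² − 5α − 1` is a prime element (norm `4`, no root of `g` mod `2` kills it). [cite: Marcus2018, Ch. 3, Thm. 22] -/
theorem prime_p2 : Prime (lin aeval_α (-1) (-5) 1 : 𝓞 (CubicField (-5) (-1) (-2))) :=
  lin_prime_of_pow irreducible aeval_α finrank_eq (-1) (-5) 1 (n := 4) (by norm_num [MonicCubic.normForm]) Nat.prime_two (Or.inl rfl)
    (by norm_num) (by decide)

/-- `α · (α² − 5α − 1) = 2`. [folklore] -/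
theorem p1_mul_p2 : (lin aeval_α 0 1 0 : 𝓞 (CubicField (-5) (-1) (-2))) * lin aeval_α (-1) (-5) 1 = 2 := by
  simp only [lin]; push_cast
  linear_combination αi_rel

/-- **At most two primes of `K` above `2`**: a prime containing `2 = α(α² − 5α − 1)` contains one of the two prime elements, hence equals `(α)` or `(α² − 5α − 1)`.
[cite: Marcus2018, Ch. 3, Thm. 27] -/
theorem ncard_dyadic_le_two :
    {w : HeightOneSpectrum (𝓞 (CubicField (-5) (-1) (-2))) | ((2 : ℕ) : 𝓞 (CubicField (-5) (-1) (-2))) ∈ w.asIdeal}.ncard ≤ 2 := by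
  classical
  set a : 𝓞 (CubicField (-5) (-1) (-2)) := lin aeval_α 0 1 0 with ha
  set b : 𝓞 (CubicField (-5) (-1) (-2)) := lin aeval_α (-1) (-5) 1 with hb
  have hpa : (Ideal.span {a}).IsPrime := (Ideal.span_singleton_prime prime_p1.ne_zero).mpr prime_p1
  have hpb : (Ideal.span {b}).IsPrime := (Ideal.span_singleton_prime prime_p2.ne_zero).mpr prime_p2
  have ha0 : Ideal.span {a} ≠ ⊥ := by rw [Ne, Ideal.span_singleton_eq_bot]; exact prime_p1.ne_zero
  have hb0 : Ideal.span {b} ≠ ⊥ := by rw [Ne, Ideal.span_singleton_eq_bot]; exact prime_p2.ne_zero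
  let wa : HeightOneSpectrum (𝓞 (CubicField (-5) (-1) (-2))) := ⟨Ideal.span {a}, hpa, ha0⟩
  let wb : HeightOneSpectrum (𝓞 (CubicField (-5) (-1) (-2))) := ⟨Ideal.span {b}, hpb, hb0⟩
  have hsub : {w : HeightOneSpectrum (𝓞 (CubicField (-5) (-1) (-2))) | ((2 : ℕ) : 𝓞 (CubicField (-5) (-1) (-2))) ∈ w.asIdeal} ⊆ {wa, wb} := by
    intro w hw
    simp only [Set.mem_setOf_eq, Nat.cast_ofNat] at hw
    haveI := w.isPrime
    have h2 : a * b ∈ w.asIdeal := by rw [ha, hb, p1_mul_p2]; exact hw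
    rcases w.isPrime.mem_or_mem h2 with h | h
    · left
      apply HeightOneSpectrum.ext
      have hle : Ideal.span {a} ≤ w.asIdeal := (Ideal.span_singleton_le_iff_mem _).mpr h
      exact ((hpa.isMaximal ha0).eq_of_le w.isPrime.ne_top hle).symm
    · right
      simp only [Set.mem_singleton_iff]
      apply HeightOneSpectrum.ext
      have hle : Ideal.span {b} ≤ w.asIdeal := (Ideal.span_singleton_le_iff_mem _).mpr h
      exact ((hpb.isMaximal hb0).eq_of_le w.isPrime.ne_top hle).symm
  calc {w : HeightOneSpectrum (𝓞 (CubicField (-5) (-1) (-2))) | ((2 : ℕ) : 𝓞 (CubicField (-5) (-1) (-2))) ∈ w.asIdeal}.ncard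
      ≤ ({wa, wb} : Set _).ncard := Set.ncard_le_ncard hsub (Set.toFinite _)
    _ ≤ 2 := (Set.ncard_insert_le _ _).trans (by rw [Set.ncard_singleton])

/-! ## §4 The odd genus-character certificate and `e₁ = 1` -/

/-- ★★ **`ord₂ h(K_1) = 1` FOR EVERY CYCLOTOMIC `ℤ₂`-EXTENSION OF THE CUBIC FIELD OF DISCRIMINANT `−1259`** — kernel, unconditional.  Certificate:
`𝔭₁ = (α)`; `ε = fu = 3 + 2α + 8α²` with `fu + 1 = (3 + 5α − α²)α³ ∈ 𝔭₁³` and `±fu` non-squares; `x = −1 − α`, `y = −α`, `α' = α − 5` (norm `7`), `u = −fu`: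
`x² − 2y² = uα'²`; `α²·α' + 1·x = 1`; `(11 + 7α + 24α²)α'² − 24·2 = 1`; `α' + 3 = (−8 − 9α + 2α²)α³ ∈ 𝔭₁³`.
[cite: Gras2003, IV.4] [cite: Serre1973CourseArithmetic, Ch. III §1.2, Thm. 1] [cite: Washington1997, §13.1] [cite: LMFDB, number field 3.1.1259.1] -/
theorem classNumberPExp_one_eq_one (κ : ZpExtension (CubicField (-5) (-1) (-2)) 2) (hκ : κ.IsCyclotomic) [NumberField (κ.layer 1)] :
    classNumberPExp κ 1 = 1 := by
  have hK : ¬ 2 ∣ Module.finrank ℚ (CubicField (-5) (-1) (-2)) := by rw [finrank_eq]; decide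
  have hd : ¬ (2 : ℤ) ∣ NumberField.discr (CubicField (-5) (-1) (-2)) := by rw [discr_eq]; decide
  set θ := MonicCubic.thetaInt aeval_α with hθ
  -- the certificate data in `lin` form
  have hε : ((fu : (𝓞 (CubicField (-5) (-1) (-2)))ˣ) : 𝓞 (CubicField (-5) (-1) (-2))) - 1 ∈
      (Ideal.span {lin aeval_α 0 1 0} : Ideal (𝓞 (CubicField (-5) (-1) (-2)))) ^ 3 ∨
      ((fu : (𝓞 (CubicField (-5) (-1) (-2)))ˣ) : 𝓞 (CubicField (-5) (-1) (-2))) + 1 ∈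
      (Ideal.span {lin aeval_α 0 1 0} : Ideal (𝓞 (CubicField (-5) (-1) (-2)))) ^ 3 := by
    right
    rw [Ideal.span_singleton_pow, Ideal.mem_span_singleton']
    refine ⟨lin aeval_α 3 5 (-1), ?_⟩
    show lin aeval_α 3 5 (-1) * lin aeval_α 0 1 0 ^ 3 = lin aeval_α 3 2 8 + 1
    simp only [lin]; push_cast
    linear_combination (2 - θ ^ 2) * αi_rel
  have hxy : (lin aeval_α (-1) (-1) 0 : 𝓞 (CubicField (-5) (-1) (-2))) ^ 2 - 2 * (lin aeval_α 0 (-1) 0) ^ 2 =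
      (((-fu : (𝓞 (CubicField (-5) (-1) (-2)))ˣ)) : 𝓞 (CubicField (-5) (-1) (-2))) * (lin aeval_α (-5) 1 0) ^ 2 := by
    rw [Units.val_neg]
    show lin aeval_α (-1) (-1) 0 ^ 2 - 2 * lin aeval_α 0 (-1) 0 ^ 2 = -(lin aeval_α 3 2 8) * lin aeval_α (-5) 1 0 ^ 2
    simp only [lin]; push_cast
    linear_combination (8 * θ - 38) * αi_rel
  have hbez : (lin aeval_α 0 0 1 : 𝓞 (CubicField (-5) (-1) (-2))) * lin aeval_α (-5) 1 0 + 1 * lin aeval_α (-1) (-1) 0 = 1 := by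
    simp only [lin]; push_cast
    linear_combination αi_rel
  have hbez' : (lin aeval_α 11 7 24 : 𝓞 (CubicField (-5) (-1) (-2))) * lin aeval_α (-5) 1 0 ^ 2 + (-24) * 2 = 1 := by
    simp only [lin]; push_cast
    linear_combination (24 * θ - 113) * αi_rel
  have hα : (lin aeval_α (-5) 1 0 : 𝓞 (CubicField (-5) (-1) (-2))) - 3 ∈
      (Ideal.span {lin aeval_α 0 1 0} : Ideal (𝓞 (CubicField (-5) (-1) (-2)))) ^ 3 ∨
      (lin aeval_α (-5) 1 0 : 𝓞 (CubicField (-5) (-1) (-2))) + 3 ∈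
      (Ideal.span {lin aeval_α 0 1 0} : Ideal (𝓞 (CubicField (-5) (-1) (-2)))) ^ 3 := by
    right
    rw [Ideal.span_singleton_pow, Ideal.mem_span_singleton']
    refine ⟨lin aeval_α (-8) (-9) 2, ?_⟩
    simp only [lin]; push_cast
    linear_combination (2 * θ ^ 2 + θ - 1) * αi_rel
  exact classNumberPExp_one_eq_one_of_genusCert_odd_of_rank_eq_one hK hd odd_classNumber rank_eq κ hκ ncard_dyadic_le_two
    (Ideal.span {lin aeval_α 0 1 0}) absNorm_p1 hε fu_ne_sq hxy hbez hbez' hα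

end Summit.BirchSwinnertonDyer.BirchSwinnertonDyer.Theorems.AlignedTransportAtTwoCubicFieldM1259LayerOne

end
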